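import Summits.AtomisticToContinuum.BoseEinsteinCondensation.Theorems.BECGroundStateSOSPeriodicIRBoundFsumDCAdjoint
import Summits.AtomisticToContinuum.BoseEinsteinCondensation.Theorems.BECGroundStateSOSPeriodicIRBoundFsumExcitedPairs
import Summits.AtomisticToContinuum.BoseEinsteinCondensation.Theorems.BECGroundStateSOSPeriodicIRBoundFsumConePhaseUp
import Summits.AtomisticToContinuum.BoseEinsteinCondensation.Theorems.BECGroundStateSOSPeriodicIRBoundFsumDichotomy
import Literature.MathematicalPhysics.QuantumManyBody.TorusFockLayer
import HarnessLib

/-!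
# Crux `RichardsonAnchorBEC` (stmt-AtomisticToContinuum-14805), route `BECRichardsonGaudin`, line `registered` —
# stub `stub_pairSquareLower` (P1): the pair-square lower bound

Step 1 of the sums-of-squares lower bound for the Richardson pairing anchor: with the band pair
annihilator `PΨ = Σ_{k ∈ B_M} a_{-k} a_k Ψ` (first quantisation, `a_k = modeAn L (planeWaveMode L k)`),
its condensate part `u = a₀ a₀ Ψ` (the `k = 0` term, `zero_mem_momentumBand`) and its excited part
`v = P_ex Ψ = Σ_{k ∈ B_M ∖ {0}} a_{-k} a_k Ψ`, so that `PΨ = u + v` (`Finset.add_sum_erase`), one has for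
every real `s ≥ 0`

  `2s ‖u‖² ≤ ‖PΨ‖² + s² ‖u‖² − 2s Σ_{k ∈ B_M ∖ {0}} Re⟨u, a_{-k} a_k Ψ⟩`,

because `0 ≤ ‖(u + v) − s u‖² = ‖u + v‖² − 2s Re⟨u + v, u⟩ + s² ‖u‖²` (`normSq_add_smul`) and
`Re⟨u + v, u⟩ = ‖u‖² + Re⟨u, v⟩` (`innerRe_comm`, `innerRe_add_right`, `innerRe_self`), with
`Re⟨u, v⟩ = Σ_k Re⟨u, a_{-k} a_k Ψ⟩` (`innerRe_finset_sum_right`: `Finset.mul_sum`, `integral_finsetSum`,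
`Complex.re_sum`). All functions are continuous (`continuous_modeAn`, `continuous_planeWaveMode`), hence
square integrable on the bounded cell (`normSq_ne_top`), and the real inequality is repackaged in `ℝ≥0∞`
(`ENNReal.ofReal_toReal`, `ENNReal.ofReal_mul`, `ENNReal.ofReal_add`, `ENNReal.ofReal_add_le`); the
negative part of the cross term is clipped by `ENNReal.ofReal`, which only weakens the bound.
-/

noncomputable section

open MeasureTheory Filter
open scoped ENNReal NNReal ComplexConjugate BigOperators

namespace Summit.AtomisticToContinuum.BoseEinsteinCondensation.Cruxes.RichardsonAnchorBEC.Birth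

open Literature.MathematicalPhysics.QuantumManyBody.BoseGas
open Summit.AtomisticToContinuum.BoseEinsteinCondensation.Cruxes.PeriodicIRBound.LinearPhFloorWagner.WF
open Summit.AtomisticToContinuum.BoseEinsteinCondensation.Cruxes.PeriodicIRBound.FsumPhasePencil

variable {m : ℕ} {L : ℝ}

/-- `Re⟨f, Σ_{k ∈ S} g_k⟩ = Σ_{k ∈ S} Re⟨f, g_k⟩` for continuous `f, g_k` on the cell (the Bochner
integral of a finite sum of integrable functions). [folklore] -/
theorem innerRe_finset_sum_right {ι : Type*} (S : Finset ι) {f : Config m → ℂ} {g : ι → Config m → ℂ}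
    (hf : Continuous f) (hg : ∀ k, Continuous (g k)) :
    innerRe L f (fun X => ∑ k ∈ S, g k X) = ∑ k ∈ S, innerRe L f (g k) := by
  unfold innerRe
  have hint : ∀ k ∈ S,
      Integrable (fun X => (starRingEnd ℂ) (f X) * g k X) (volume.restrict (cellN m L)) :=
    fun k _ => integrableOn_cellN ((Complex.continuous_conj.comp hf).mul (hg k)) L
  simp only [Finset.mul_sum]
  rw [integral_finsetSum S hint, Complex.re_sum]

/-- The real pair-square inequality: for continuous `u, v` on the cell and real `s`,
`2s ‖u‖² ≤ ‖u + v‖² + s² ‖u‖² − 2s Re⟨u, v⟩`, i.e. `0 ≤ ‖(u + v) − s u‖²` expanded. [folklore] -/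
theorem two_mul_normSq_le_pairSquare (hL : 0 < L) {u v : Config m → ℂ} (hu : Continuous u)
    (hv : Continuous v) (s : ℝ) :
    2 * s * (normSq L u).toReal ≤
      (normSq L (fun X => u X + v X)).toReal + s ^ 2 * (normSq L u).toReal
        - 2 * s * innerRe L u v := by
  have hP : Continuous fun X => u X + v X := hu.add hv
  have h := normSq_add_smul hL hP hu (-s)
  have hPu : innerRe L (fun X => u X + v X) u = (normSq L u).toReal + innerRe L u v := by
    rw [innerRe_comm, innerRe_add_right hu hu hv, innerRe_self hu]
  have h0 : 0 ≤ (normSq L (fun X => (u X + v X) + ((-s : ℝ) : ℂ) * u X)).toReal :=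
    ENNReal.toReal_nonneg
  rw [h, hPu, neg_sq] at h0
  linarith

/-- The pair-square inequality in `ℝ≥0∞`: for continuous `u, v` on the cell and `s ≥ 0`,
`2s ‖u‖² ≤ ‖u + v‖² + s² ‖u‖² + (−2s Re⟨u, v⟩)₊`. [folklore] -/
theorem ofReal_two_mul_mul_normSq_le (hL : 0 < L) {u v : Config m → ℂ} (hu : Continuous u)
    (hv : Continuous v) {s : ℝ} (hs : 0 ≤ s) {X : ℝ} (hX : innerRe L u v = X) :
    ENNReal.ofReal (2 * s) * normSq L u ≤
      normSq L (fun Y => u Y + v Y) + ENNReal.ofReal (s ^ 2) * normSq L u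
        + ENNReal.ofReal (-(2 * s * X)) := by
  have hreal := two_mul_normSq_le_pairSquare hL hu hv s
  rw [hX] at hreal
  have hA : normSq L u = ENNReal.ofReal (normSq L u).toReal :=
    (ENNReal.ofReal_toReal (normSq_ne_top L hu)).symm
  have hPn : normSq L (fun Y => u Y + v Y) = ENNReal.ofReal (normSq L (fun Y => u Y + v Y)).toReal :=
    (ENNReal.ofReal_toReal (normSq_ne_top L (hu.add hv))).symm
  have hA0 : 0 ≤ (normSq L u).toReal := ENNReal.toReal_nonneg
  have hP0 : 0 ≤ (normSq L (fun Y => u Y + v Y)).toReal := ENNReal.toReal_nonneg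
  rw [hA, hPn, ← ENNReal.ofReal_mul (by positivity), ← ENNReal.ofReal_mul (sq_nonneg s),
    ← ENNReal.ofReal_add hP0 (by positivity)]
  calc ENNReal.ofReal (2 * s * (normSq L u).toReal)
      ≤ ENNReal.ofReal ((normSq L (fun Y => u Y + v Y)).toReal + s ^ 2 * (normSq L u).toReal
          + -(2 * s * X)) := ENNReal.ofReal_le_ofReal (by linarith)
    _ ≤ ENNReal.ofReal ((normSq L (fun Y => u Y + v Y)).toReal + s ^ 2 * (normSq L u).toReal)
          + ENNReal.ofReal (-(2 * s * X)) := ENNReal.ofReal_add_le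

/-- **Pair-square lower bound** (step 1 of the sums-of-squares lower bound for the Richardson anchor):
with `u = a₀a₀Ψ`, `PΨ = Σ_{k ∈ B_M} a_{-k}a_kΨ = u + P_exΨ`, for every `s ≥ 0`,
`2s‖u‖² ≤ ‖PΨ‖² + s²‖u‖² + (−2s Σ_{k ∈ B_M ∖ {0}} Re⟨u, a_{-k}a_kΨ⟩)₊` in `ℝ≥0∞` — the first-quantised
form of `P†P ≥ (2s − s²) a₀†²a₀² + s (a₀†² P_ex + h.c.)`, from `(P − s a₀²)†(P − s a₀²) ≥ 0`. [folklore] -/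
theorem stub_pairSquareLower :
    ∀ (L s : ℝ) (n M : ℕ), 0 < L → 0 ≤ s → ∀ Φ : PeriodicTrialState (n + 2) L,
      ENNReal.ofReal (2 * s) *
          normSq L (modeAn L (planeWaveMode L 0) (modeAn L (planeWaveMode L 0) Φ.ψ)) ≤
        normSq L (fun Y => ∑ k ∈ momentumBand M,
            modeAn L (planeWaveMode L (-k)) (modeAn L (planeWaveMode L k) Φ.ψ) Y) +
          ENNReal.ofReal (s ^ 2) *
            normSq L (modeAn L (planeWaveMode L 0) (modeAn L (planeWaveMode L 0) Φ.ψ)) +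
          ENNReal.ofReal (-(2 * s * ∑ k ∈ (momentumBand M).erase 0,
            innerRe L (modeAn L (planeWaveMode L 0) (modeAn L (planeWaveMode L 0) Φ.ψ))
              (modeAn L (planeWaveMode L (-k)) (modeAn L (planeWaveMode L k) Φ.ψ)))) := by
  intro L s n M hL hs Φ
  have hΨ : Continuous Φ.ψ := Φ.contDiff.continuous
  have ha : ∀ k : Fin 3 → ℤ,
      Continuous (modeAn L (planeWaveMode L (-k)) (modeAn L (planeWaveMode L k) Φ.ψ)) := fun k =>
    continuous_modeAn L (continuous_planeWaveMode L (-k))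
      (continuous_modeAn L (continuous_planeWaveMode L k) hΨ)
  have hu : Continuous (modeAn L (planeWaveMode L 0) (modeAn L (planeWaveMode L 0) Φ.ψ)) :=
    continuous_modeAn L (continuous_planeWaveMode L 0)
      (continuous_modeAn L (continuous_planeWaveMode L 0) hΨ)
  have hv : Continuous fun Y => ∑ k ∈ (momentumBand M).erase 0,
      modeAn L (planeWaveMode L (-k)) (modeAn L (planeWaveMode L k) Φ.ψ) Y :=
    continuous_finsetSum _ fun k _ => ha k
  have hsplit : (fun Y => ∑ k ∈ momentumBand M,
      modeAn L (planeWaveMode L (-k)) (modeAn L (planeWaveMode L k) Φ.ψ) Y) =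
      fun Y => modeAn L (planeWaveMode L 0) (modeAn L (planeWaveMode L 0) Φ.ψ) Y +
        ∑ k ∈ (momentumBand M).erase 0,
          modeAn L (planeWaveMode L (-k)) (modeAn L (planeWaveMode L k) Φ.ψ) Y := by
    funext Y
    rw [← Finset.add_sum_erase _ _ (zero_mem_momentumBand M)]
    simp only [neg_zero]
  rw [hsplit]
  exact ofReal_two_mul_mul_normSq_le hL hu hv hs
    (innerRe_finset_sum_right ((momentumBand M).erase 0) hu ha)

end Summit.AtomisticToContinuum.BoseEinsteinCondensation.Cruxes.RichardsonAnchorBEC.Birth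

end
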